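import Literature.NumberTheory.QuadraticFields.EpsteinZetaFifteenSublattices
import Literature.NumberTheory.QuadraticFields.ChowlaSelbergFormula
import HarnessLib

/-!
# The Chowla–Selberg product for discriminant `−60` (the "5/3 singular value")

Topic `NumberTheory/QuadraticFields`. THEOREMS only (no definitions, no named facts).

Discriminant `−60 = −15·2²` is NOT fundamental (order of conductor `2` in `ℚ(√−15)`); its two
primitive reduced forms are `Q₃ = x² + 15y²` and `Q₅ = 3x² + 5y²`, with root points
`τ_{Q₃} = i√15`, `τ_{Q₅} = i√(5/3)` (`rootPoint 1 0 15`, `rootPoint 3 0 5`). Writing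
`Z_j(s) = Σ' Q_j(x,y)^{−s}` and `Q₁ = x² + xy + 4y²`, `Q₂ = 2x² + xy + 2y²` for the two reduced
forms of discriminant `−15`, elementary index-`2` sublattice dissections give

* `epsteinZeta_three_zero_five` — **`Z₅(s) = (1 + 2·4^{−s}) Z₂(s) − 2·2^{−s} Z₁(s)`** (the companion
  of the tree's `epsteinZeta_one_zero_fifteen`: `Z₃ = (1 + 2·4^{−s})Z₁ − 2·2^{−s}Z₂`; here the
  three sublattices `2∣x`, `2∣y`, `x ≡ y (2)` carry `Q₂` to `2Q₁`, `2Q₁`, `Q₅`);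
* `sum_epsteinZeta_neg_sixty` — **`Z₃ + Z₅ = (1 − 2·2^{−s} + 2·4^{−s})(Z₁ + Z₂)`**
  `= 2(1 − 2^{1−s} + 2^{1−2s}) ζ(s) L(s, χ₋₁₅)` for `Re s > 1` — the zeta function of the order of
  discriminant `−60` (Siegel, Ch. II §3; the local factor at `2` reflects `χ₋₁₅(2) = +1`);
* `chowlaSelberg_log_sixty` — comparing constant terms in Kronecker's limit formula
  (`KroneckerLimit.tendsto_epsteinZeta_sub_pole_eta`) on both sides (the factor
  `g(s) = 1 − 2·2^{−s} + 2·4^{−s}` has `g(1) = 1/2`, `g'(1) = 0`, indeed `2g − 1 = (1 − 2·2^{−s})²`):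
  `log 60 + 4 log|η(i√15)| + log 20 + 4 log|η(i√(5/3))| = log 15 + 4 log|η(τ₁)| + log(15/2) + 4 log|η(τ₂)|`
  with `τ₁ = (1 + i√15)/2`, `τ₂ = (1 + i√15)/4`;
* `chowlaSelberg_sixty_prod` — **`|η(i√15)|⁴ |η(i√(5/3))|⁴ = (3/32) |η(τ₁)|⁴ |η(τ₂)|⁴`
  `= Γ(1/15)Γ(2/15)Γ(4/15)Γ(8/15) / (4800 π² Γ(7/15)Γ(11/15)Γ(13/15)Γ(14/15))`** (with the tree's
  `chowlaSelberg_fifteen_prod`).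

These are the `η`-values at `2τ₀ + 1 = i√(5/3)` and `6τ₀ + 3 = i√15` for the CM point
`τ₀ = −1/2 + i√15/6` of [BorweinEtAl2012, §4 Remark 7 / Thm. 9] ("the 5/3rd singular value"),
where `p₄(1) = (6(2τ₀+1)/π) η(τ₀)η(2τ₀)η(3τ₀)η(6τ₀)`; together with `|η(τ₀)η(3τ₀)|` (discriminant
`−15`, `chowlaSelberg_fifteen_prod`) they give `p₄(1) = √(Γ(1/15)Γ(2/15)Γ(4/15)Γ(8/15) /
(5 Γ(7/15)Γ(11/15)Γ(13/15)Γ(14/15))) / (2π²)`.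

## References

* A. Selberg, S. Chowla, On Epstein's zeta-function, J. reine angew. Math. 227 (1967) 86–110, §2.
* C. L. Siegel, *Advanced Analytic Number Theory*, TIFR (1980), Ch. II §3 (zeta functions of orders
  and sublattices).
* I. J. Zucker, M. M. Robertson, Exact values of some two-dimensional lattice sums, J. Phys. A 8
  (1975) 874–881 (Table: `D = −15, −60`).
* [BorweinEtAl2012] J. M. Borwein, A. Straub, J. Wan, W. Zudilin, *Densities of short uniform random
  walks*, Canad. J. Math. 64 (2012), §5 (the `5/3` singular value), Thm. 9.
-/

noncomputable section

open Complex Filter Topology Finset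
open scoped Real

open Literature.Barriers.RiemannHypothesis
open Literature.NumberTheory.QuadraticFields.KroneckerLimit (rootPoint tendsto_epsteinZeta_sub_pole_eta)
open Literature.NumberTheory.QuadraticFields.Quadratic (tendsto_ofReal_nhdsGT_one)
open Literature.NumberTheory.QuadraticFields.ChowlaSelbergFifteen (tsum_indicator_epsteinTerm_eq
  map_eq_zero_iff isPosDefForm_Q₁ isPosDefForm_Q₂ isPosDefForm_Q₃ indicator_identity
  epsteinZeta_one_zero_fifteen epsteinZeta_add_eq)
open Literature.NumberTheory.QuadraticFields.ChowlaSelberg (chowlaSelberg_fifteen_prod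
  rootPoint_mem_upperHalfPlaneSet)
open Literature.NumberTheory.QuadraticFields (jacobiChar)

namespace Literature.NumberTheory.QuadraticFields.ChowlaSelbergSixty

/-! ### The form `3x² + 5y²` and the index-2 sublattices for `Q₂ = 2x² + xy + 2y²` -/

/-- `3x² + 5y²` is positive definite. [folklore] -/
theorem isPosDefForm_Q₅ : IsPosDefForm 3 0 5 := ⟨by norm_num, by norm_num⟩

/-- `x` even: `Σ'_{2∣x} Q₂^{−s} = 2^{−s} Z₁` via `(u,v) ↦ (2v, u)`, `Q₂(2v,u) = 2Q₁(u,v)`. [folklore] -/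
theorem tsum_even_fst_Q₂ (s : ℂ) :
    ∑' p : ℤ × ℤ, {p : ℤ × ℤ | (2 : ℤ) ∣ p.1}.indicator (epsteinTerm 2 1 2 s) p =
      (2 : ℂ) ^ (-s) * epsteinZeta 1 1 4 s := by
  have hφ : Function.Injective (fun u : ℤ × ℤ => (2 * u.2, u.1)) := by
    rintro ⟨a, b⟩ ⟨c, d⟩ h
    simp only [Prod.mk.injEq] at h ⊢
    omega
  have hS : Set.range (fun u : ℤ × ℤ => (2 * u.2, u.1)) = {p : ℤ × ℤ | (2 : ℤ) ∣ p.1} := by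
    ext ⟨x, y⟩
    simp only [Set.mem_range, Set.mem_setOf_eq, Prod.mk.injEq]
    constructor
    · rintro ⟨⟨u, v⟩, h1, -⟩
      exact ⟨v, by simp only at h1; linarith⟩
    · rintro ⟨w, hw⟩
      exact ⟨(y, w), show 2 * w = x ∧ y = y from ⟨by omega, rfl⟩⟩
  have hval : ∀ u : ℤ × ℤ, bqfEval 2 1 2 ((fun u : ℤ × ℤ => (2 * u.2, u.1)) u) =
      2 * bqfEval 1 1 4 u := fun u => by
    simp only [bqfEval]; push_cast; ring
  have h := tsum_indicator_epsteinTerm_eq (by norm_num : (0 : ℝ) < 2) isPosDefForm_Q₁ hφ hS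
    (map_eq_zero_iff hφ (by simp)) hval s
  exact_mod_cast h

/-- `y` even: `Σ'_{2∣y} Q₂^{−s} = 2^{−s} Z₁` via `(u,v) ↦ (u, 2v)`, `Q₂(u,2v) = 2Q₁(u,v)`. [folklore] -/
theorem tsum_even_snd_Q₂ (s : ℂ) :
    ∑' p : ℤ × ℤ, {p : ℤ × ℤ | (2 : ℤ) ∣ p.2}.indicator (epsteinTerm 2 1 2 s) p =
      (2 : ℂ) ^ (-s) * epsteinZeta 1 1 4 s := by
  have hφ : Function.Injective (fun u : ℤ × ℤ => (u.1, 2 * u.2)) := by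
    rintro ⟨a, b⟩ ⟨c, d⟩ h
    simp only [Prod.mk.injEq] at h ⊢
    omega
  have hS : Set.range (fun u : ℤ × ℤ => (u.1, 2 * u.2)) = {p : ℤ × ℤ | (2 : ℤ) ∣ p.2} := by
    ext ⟨x, y⟩
    simp only [Set.mem_range, Set.mem_setOf_eq, Prod.mk.injEq]
    constructor
    · rintro ⟨⟨u, v⟩, -, h2⟩
      exact ⟨v, by simp only at h2; linarith⟩
    · rintro ⟨w, hw⟩
      exact ⟨(x, w), show x = x ∧ 2 * w = y from ⟨rfl, by omega⟩⟩
  have hval : ∀ u : ℤ × ℤ, bqfEval 2 1 2 ((fun u : ℤ × ℤ => (u.1, 2 * u.2)) u) =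
      2 * bqfEval 1 1 4 u := fun u => by
    simp only [bqfEval]; push_cast; ring
  have h := tsum_indicator_epsteinTerm_eq (by norm_num : (0 : ℝ) < 2) isPosDefForm_Q₁ hφ hS
    (map_eq_zero_iff hφ (by simp)) hval s
  exact_mod_cast h

/-- `x ≡ y (mod 2)`: `Σ'_{2∣x−y} Q₂^{−s} = Z₅` via `(u,v) ↦ (u − v, −u − v)`,
`Q₂(u−v, −u−v) = 3u² + 5v²`. [folklore] -/
theorem tsum_even_sub_Q₂ (s : ℂ) :
    ∑' p : ℤ × ℤ, {p : ℤ × ℤ | (2 : ℤ) ∣ p.1 - p.2}.indicator (epsteinTerm 2 1 2 s) p =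
      epsteinZeta 3 0 5 s := by
  have hφ : Function.Injective (fun u : ℤ × ℤ => (u.1 - u.2, -u.1 - u.2)) := by
    rintro ⟨a, b⟩ ⟨c, d⟩ h
    simp only [Prod.mk.injEq] at h ⊢
    omega
  have hS : Set.range (fun u : ℤ × ℤ => (u.1 - u.2, -u.1 - u.2)) =
      {p : ℤ × ℤ | (2 : ℤ) ∣ p.1 - p.2} := by
    ext ⟨x, y⟩
    simp only [Set.mem_range, Set.mem_setOf_eq, Prod.mk.injEq]
    constructor
    · rintro ⟨⟨u, v⟩, h1, h2⟩
      exact ⟨u, by simp only at h1 h2; linarith⟩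
    · rintro ⟨w, hw⟩
      refine ⟨(w, -w - y), ?_, ?_⟩ <;> simp only <;> omega
  have hval : ∀ u : ℤ × ℤ, bqfEval 2 1 2 ((fun u : ℤ × ℤ => (u.1 - u.2, -u.1 - u.2)) u) =
      1 * bqfEval 3 0 5 u := fun u => by
    simp only [bqfEval]; push_cast; ring
  have h := tsum_indicator_epsteinTerm_eq (by norm_num : (0 : ℝ) < 1) isPosDefForm_Q₅ hφ hS
    (map_eq_zero_iff hφ (by simp)) hval s
  rw [h]
  simp

/-- Both even: `Σ'_{2∣x, 2∣y} Q₂^{−s} = 4^{−s} Z₂` via `(u,v) ↦ (2u, 2v)`. [folklore] -/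
theorem tsum_even_even_Q₂ (s : ℂ) :
    ∑' p : ℤ × ℤ, {p : ℤ × ℤ | (2 : ℤ) ∣ p.1 ∧ (2 : ℤ) ∣ p.2}.indicator (epsteinTerm 2 1 2 s) p =
      (4 : ℂ) ^ (-s) * epsteinZeta 2 1 2 s := by
  have hφ : Function.Injective (fun u : ℤ × ℤ => (2 * u.1, 2 * u.2)) := by
    rintro ⟨a, b⟩ ⟨c, d⟩ h
    simp only [Prod.mk.injEq] at h ⊢
    omega
  have hS : Set.range (fun u : ℤ × ℤ => (2 * u.1, 2 * u.2)) =
      {p : ℤ × ℤ | (2 : ℤ) ∣ p.1 ∧ (2 : ℤ) ∣ p.2} := by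
    ext ⟨x, y⟩
    simp only [Set.mem_range, Set.mem_setOf_eq, Prod.mk.injEq]
    constructor
    · rintro ⟨⟨u, v⟩, h1, h2⟩
      exact ⟨⟨u, by simp only at h1; linarith⟩, ⟨v, by simp only at h2; linarith⟩⟩
    · rintro ⟨⟨w, hw⟩, ⟨z, hz⟩⟩
      exact ⟨(w, z), show 2 * w = x ∧ 2 * z = y from ⟨by omega, by omega⟩⟩
  have hval : ∀ u : ℤ × ℤ, bqfEval 2 1 2 ((fun u : ℤ × ℤ => (2 * u.1, 2 * u.2)) u) =
      4 * bqfEval 2 1 2 u := fun u => by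
    simp only [bqfEval]; push_cast; ring
  have h := tsum_indicator_epsteinTerm_eq (by norm_num : (0 : ℝ) < 4) isPosDefForm_Q₂ hφ hS
    (map_eq_zero_iff hφ (by simp)) hval s
  exact_mod_cast h

/-- **`Z₅(s) = (1 + 2·4^{−s}) Z₂(s) − 2·2^{−s} Z₁(s)`** for `Re s > 1` (`Z₅ = Z_{(3,0,5)}`): the lattice
sum of `Q₂` splits over the three index-`2` sublattices, carrying `Q₂` to `2Q₁`, `2Q₁`, `Q₅` and
meeting in `2ℤ²` (`4Q₂`). [folklore] -/
theorem epsteinZeta_three_zero_five {s : ℂ} (hs : 1 < s.re) :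
    epsteinZeta 3 0 5 s =
      (1 + 2 * (4 : ℂ) ^ (-s)) * epsteinZeta 2 1 2 s - 2 * (2 : ℂ) ^ (-s) * epsteinZeta 1 1 4 s := by
  set f := epsteinTerm 2 1 2 s with hf
  have hsum : Summable f := (summable_norm_epsteinTerm isPosDefForm_Q₂ hs).of_norm
  have hA := hsum.indicator {p : ℤ × ℤ | (2 : ℤ) ∣ p.1}
  have hB := hsum.indicator {p : ℤ × ℤ | (2 : ℤ) ∣ p.2}
  have hC := hsum.indicator {p : ℤ × ℤ | (2 : ℤ) ∣ p.1 - p.2}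
  have hD := hsum.indicator {p : ℤ × ℤ | (2 : ℤ) ∣ p.1 ∧ (2 : ℤ) ∣ p.2}
  have hZ2 : epsteinZeta 2 1 2 s = ∑' p, f p := rfl
  have hsplit : ∑' p, f p =
      ∑' p, {p : ℤ × ℤ | (2 : ℤ) ∣ p.1}.indicator f p + ∑' p, {p : ℤ × ℤ | (2 : ℤ) ∣ p.2}.indicator f p +
        ∑' p, {p : ℤ × ℤ | (2 : ℤ) ∣ p.1 - p.2}.indicator f p -
          2 * ∑' p, {p : ℤ × ℤ | (2 : ℤ) ∣ p.1 ∧ (2 : ℤ) ∣ p.2}.indicator f p := by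
    rw [← tsum_mul_left, ← hA.tsum_add hB, ← (hA.add hB).tsum_add hC,
      ← ((hA.add hB).add hC).tsum_sub (hD.mul_left 2)]
    exact tsum_congr fun p => indicator_identity f p
  rw [hf, tsum_even_fst_Q₂, tsum_even_snd_Q₂, tsum_even_sub_Q₂, tsum_even_even_Q₂] at hsplit
  rw [hZ2, hf] at *
  linear_combination (-1 : ℂ) * hsplit

/-! ### The zeta function of the order of discriminant `−60` -/

/-- `4^{−s} = 2^{−s}·2^{−s}`. [folklore] -/
theorem four_cpow_neg (s : ℂ) : (4 : ℂ) ^ (-s) = (2 : ℂ) ^ (-s) * (2 : ℂ) ^ (-s) := by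
  have h := Complex.mul_cpow_ofReal_nonneg (by norm_num : (0 : ℝ) ≤ 2) (by norm_num : (0 : ℝ) ≤ 2) (-s)
  push_cast at h
  rw [show (2 : ℂ) * 2 = 4 by norm_num] at h
  exact h

/-- **The lattice sums of discriminant `−60` in terms of those of discriminant `−15`**:
`Z₃(s) + Z₅(s) = (1 − 2·2^{−s} + 2·4^{−s}) (Z₁(s) + Z₂(s))` for `Re s > 1`. [folklore] -/
theorem sum_epsteinZeta_neg_sixty {s : ℂ} (hs : 1 < s.re) :
    epsteinZeta 1 0 15 s + epsteinZeta 3 0 5 s =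
      (1 - 2 * (2 : ℂ) ^ (-s) + 2 * (4 : ℂ) ^ (-s)) * (epsteinZeta 1 1 4 s + epsteinZeta 2 1 2 s) := by
  rw [epsteinZeta_one_zero_fifteen hs, epsteinZeta_three_zero_five hs]
  ring

/-- **`Z₃(s) + Z₅(s) = 2 (1 − 2^{1−s} + 2^{1−2s}) ζ(s) L(s, χ₋₁₅)`** for `Re s > 1`: the zeta function
of the (non-maximal) order of discriminant `−60`, whose local factor at `2` differs from that of
`ℚ(√−15)` (`χ₋₁₅(2) = 1`). [folklore] -/
theorem sum_epsteinZeta_neg_sixty_eq_zeta_mul {s : ℂ} (hs : 1 < s.re) :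
    epsteinZeta 1 0 15 s + epsteinZeta 3 0 5 s =
      (1 - 2 * (2 : ℂ) ^ (-s) + 2 * (4 : ℂ) ^ (-s)) *
        (2 * (riemannZeta s * LSeries (fun n => jacobiChar 15 n) s)) := by
  rw [sum_epsteinZeta_neg_sixty hs, epsteinZeta_add_eq hs]

/-! ### Kronecker's limit formula on both sides -/

/-- The factor `g(s) = 1 − 2·2^{−s} + 2·4^{−s}` is continuous with `g(1) = 1/2`. [folklore] -/
theorem tendsto_gFactor :
    Tendsto (fun s : ℝ => 1 - 2 * (2 : ℂ) ^ (-(s : ℂ)) + 2 * (4 : ℂ) ^ (-(s : ℂ))) (𝓝[>] 1)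
      (𝓝 (1 / 2)) := by
  have hc : Continuous fun s : ℝ => 1 - 2 * (2 : ℂ) ^ (-(s : ℂ)) + 2 * (4 : ℂ) ^ (-(s : ℂ)) := by
    have h2 : Continuous fun s : ℝ => (2 : ℂ) ^ (-(s : ℂ)) :=
      Continuous.const_cpow (by fun_prop) (Or.inl two_ne_zero)
    have h4 : Continuous fun s : ℝ => (4 : ℂ) ^ (-(s : ℂ)) :=
      Continuous.const_cpow (by fun_prop) (Or.inl (by norm_num))
    fun_prop
  have h1 : (1 : ℂ) - 2 * (2 : ℂ) ^ (-((1 : ℝ) : ℂ)) + 2 * (4 : ℂ) ^ (-((1 : ℝ) : ℂ)) = 1 / 2 := by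
    rw [Complex.ofReal_one, Complex.cpow_neg_one, Complex.cpow_neg_one]
    norm_num
  rw [← h1]
  exact (hc.tendsto 1).mono_left nhdsWithin_le_nhds

/-- `(2g(s) − 1)/(s − 1) → 0` as `s → 1⁺` (`2g − 1 = (1 − 2·2^{−s})²` vanishes to second order).
[folklore] -/
theorem tendsto_gFactor_sub_div :
    Tendsto (fun s : ℝ => (2 * (1 - 2 * (2 : ℂ) ^ (-(s : ℂ)) + 2 * (4 : ℂ) ^ (-(s : ℂ))) - 1) /
      ((s : ℂ) - 1)) (𝓝[>] 1) (𝓝 0) := by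
  -- `u(s) = 1 − 2·2^{−s}` has `u(1) = 0` and a derivative at `1`
  set u : ℂ → ℂ := fun z => 1 - 2 * (2 : ℂ) ^ (-z) with hu
  have hu1 : u 1 = 0 := by simp [hu, Complex.cpow_neg_one]
  have hud : HasDerivAt u (-(2 * ((2 : ℂ) ^ (-(1 : ℂ)) * Complex.log 2 * -1))) 1 := by
    have h : HasDerivAt (fun z : ℂ => (2 : ℂ) ^ (-z)) ((2 : ℂ) ^ (-(1 : ℂ)) * Complex.log 2 * -1) 1 :=
      (hasDerivAt_neg (1 : ℂ)).const_cpow (Or.inl two_ne_zero)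
    simpa [hu] using (h.const_mul 2).const_sub 1
  have hslope : Tendsto (fun s : ℝ => (u s - u 1) / ((s : ℂ) - 1)) (𝓝[>] 1)
      (𝓝 (-(2 * ((2 : ℂ) ^ (-(1 : ℂ)) * Complex.log 2 * -1)))) := by
    have h1 := (hasDerivAt_iff_tendsto_slope.mp hud).comp tendsto_ofReal_nhdsGT_one
    refine h1.congr fun s => ?_
    simp only [Function.comp_apply, slope_def_field]
  have hu0 : Tendsto (fun s : ℝ => u s) (𝓝[>] 1) (𝓝 0) := by
    have hc : Continuous u := by
      simp only [hu]
      exact continuous_const.sub (continuous_const.mul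
        (Continuous.const_cpow continuous_neg (Or.inl two_ne_zero)))
    have := (hc.tendsto (1 : ℂ)).comp
      ((Complex.continuous_ofReal.tendsto (1 : ℝ)).mono_left (nhdsWithin_le_nhds (s := Set.Ioi 1)))
    rw [hu1] at this
    exact this
  have hprod := hslope.mul hu0
  rw [mul_zero] at hprod
  refine hprod.congr' ?_
  filter_upwards [self_mem_nhdsWithin] with s hs
  rw [hu1, sub_zero]
  have hsq : 2 * (1 - 2 * (2 : ℂ) ^ (-(s : ℂ)) + 2 * (4 : ℂ) ^ (-(s : ℂ))) - 1 = u s * u s := by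
    simp only [hu]
    rw [four_cpow_neg]
    ring
  rw [hsq]
  ring

/-- **The Chowla–Selberg relation between discriminants `−60` and `−15` (logarithmic form)**:
`log 60 + 4 log|η(i√15)| + log 20 + 4 log|η(i√(5/3))| = log 15 + 4 log|η(τ₁)| + log(15/2) + 4 log|η(τ₂)|`,
`τ₁ = (1+i√15)/2`, `τ₂ = (1+i√15)/4`, by comparing the constant terms at `s = 1` of
`Z₃ + Z₅ = g(s)(Z₁ + Z₂)` through Kronecker's limit formula (`g(1) = 1/2`, `g'(1) = 0`, and the
polar parts `2·2π/√60 = 2π/√15 · 2 · g(1)` agree). [folklore] -/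
theorem chowlaSelberg_log_sixty :
    Real.log 60 + 4 * Real.log ‖ModularForm.eta (rootPoint 1 0 15)‖ +
        (Real.log 20 + 4 * Real.log ‖ModularForm.eta (rootPoint 3 0 5)‖) =
      Real.log 15 + 4 * Real.log ‖ModularForm.eta (rootPoint 1 1 4)‖ +
        (Real.log (15 / 2) + 4 * Real.log ‖ModularForm.eta (rootPoint 2 1 2)‖) := by
  -- Kronecker's limit formula for the four forms
  have k1 := tendsto_epsteinZeta_sub_pole_eta isPosDefForm_Q₁
  have k2 := tendsto_epsteinZeta_sub_pole_eta isPosDefForm_Q₂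
  have k3 := tendsto_epsteinZeta_sub_pole_eta isPosDefForm_Q₃
  have k5 := tendsto_epsteinZeta_sub_pole_eta isPosDefForm_Q₅
  rw [show (4 : ℝ) * 1 * 4 - 1 ^ 2 = 15 by norm_num] at k1
  rw [show (4 : ℝ) * 2 * 2 - 1 ^ 2 = 15 by norm_num] at k2
  rw [show (4 : ℝ) * 1 * 15 - 0 ^ 2 = 60 by norm_num] at k3
  rw [show (4 : ℝ) * 3 * 5 - 0 ^ 2 = 60 by norm_num] at k5
  -- abbreviations for the constants
  set c : ℝ := 2 * π / Real.sqrt 15 with hc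
  have hsqrt : Real.sqrt 60 = 2 * Real.sqrt 15 := by
    rw [show (60 : ℝ) = 2 ^ 2 * 15 by norm_num, Real.sqrt_mul (by norm_num) 15,
      Real.sqrt_sq (by norm_num)]
  have hc60 : 2 * π / Real.sqrt 60 = c / 2 := by rw [hc, hsqrt]; ring
  rw [hc60] at k3 k5
  set A₁ : ℝ := 2 * Real.eulerMascheroniConstant - Real.log (15 / 1) -
    4 * Real.log ‖ModularForm.eta (rootPoint 1 1 4)‖ with hA₁
  set A₂ : ℝ := 2 * Real.eulerMascheroniConstant - Real.log (15 / 2) -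
    4 * Real.log ‖ModularForm.eta (rootPoint 2 1 2)‖ with hA₂
  set A₃ : ℝ := 2 * Real.eulerMascheroniConstant - Real.log (60 / 1) -
    4 * Real.log ‖ModularForm.eta (rootPoint 1 0 15)‖ with hA₃
  set A₅ : ℝ := 2 * Real.eulerMascheroniConstant - Real.log (60 / 3) -
    4 * Real.log ‖ModularForm.eta (rootPoint 3 0 5)‖ with hA₅
  -- (i) the −15 side: `Z₁ + Z₂ − 2c/(s−1) → c(A₁ + A₂)`
  have h15 : Tendsto (fun s : ℝ => epsteinZeta 1 1 4 s + epsteinZeta 2 1 2 s -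
      2 * (c : ℂ) / ((s : ℂ) - 1)) (𝓝[>] 1) (𝓝 (((c * A₁ : ℝ) : ℂ) + ((c * A₂ : ℝ) : ℂ))) := by
    refine (k1.add k2).congr fun s => ?_
    ring
  -- (ii) the −60 side: `Z₃ + Z₅ − c/(s−1) → (c/2)(A₃ + A₅)`
  have h60 : Tendsto (fun s : ℝ => epsteinZeta 1 0 15 s + epsteinZeta 3 0 5 s -
      (c : ℂ) / ((s : ℂ) - 1)) (𝓝[>] 1) (𝓝 (((c / 2 * A₃ : ℝ) : ℂ) + ((c / 2 * A₅ : ℝ) : ℂ))) := by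
    refine (k3.add k5).congr fun s => ?_
    push_cast
    ring
  -- (iii) the −60 side computed from the −15 side through `g`
  have h60' : Tendsto (fun s : ℝ => epsteinZeta 1 0 15 s + epsteinZeta 3 0 5 s -
      (c : ℂ) / ((s : ℂ) - 1)) (𝓝[>] 1)
      (𝓝 ((1 / 2) * (((c * A₁ : ℝ) : ℂ) + ((c * A₂ : ℝ) : ℂ)) + (c : ℂ) * 0)) := by
    have hmain := (tendsto_gFactor.mul h15).add (tendsto_gFactor_sub_div.const_mul (c : ℂ))
    refine hmain.congr' ?_
    filter_upwards [self_mem_nhdsWithin] with s hs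
    have hs1 : (s : ℂ) - 1 ≠ 0 := by
      rw [sub_ne_zero, Ne, Complex.ofReal_eq_one]
      exact ne_of_gt hs
    have hsre : 1 < (s : ℂ).re := by simpa using hs
    rw [sum_epsteinZeta_neg_sixty hsre]
    field_simp
    ring
  have heq := tendsto_nhds_unique h60 h60'
  rw [mul_zero, add_zero] at heq
  -- back to real numbers
  have hcpos : 0 < c := by rw [hc]; positivity
  have hreal : c / 2 * A₃ + c / 2 * A₅ = 1 / 2 * (c * A₁ + c * A₂) := by
    have h' := heq
    push_cast at h'
    apply Complex.ofReal_injective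
    push_cast
    linear_combination h'
  have hA : A₃ + A₅ = A₁ + A₂ := by
    have h2 : c / 2 * (A₃ + A₅) = c / 2 * (A₁ + A₂) := by linear_combination hreal
    exact mul_left_cancel₀ (by positivity) h2
  simp only [hA₁, hA₂, hA₃, hA₅] at hA
  have hl1 : Real.log (15 / 1) = Real.log 15 := by norm_num
  have hl2 : Real.log (60 / 1) = Real.log 60 := by norm_num
  have hl3 : Real.log (60 / 3) = Real.log 20 := by norm_num
  rw [hl1, hl2, hl3] at hA
  linarith

/-- **The Chowla–Selberg product for discriminant `−60`**:
`|η(i√15)|⁴ |η(i√(5/3))|⁴ = (3/32) |η((1+i√15)/2)|⁴ |η((1+i√15)/4)|⁴`. [folklore] -/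
theorem norm_eta_sixty_prod :
    ‖ModularForm.eta (rootPoint 1 0 15)‖ ^ 4 * ‖ModularForm.eta (rootPoint 3 0 5)‖ ^ 4 =
      3 / 32 * (‖ModularForm.eta (rootPoint 1 1 4)‖ ^ 4 * ‖ModularForm.eta (rootPoint 2 1 2)‖ ^ 4) := by
  have h := chowlaSelberg_log_sixty
  have hη1 : 0 < ‖ModularForm.eta (rootPoint 1 1 4)‖ :=
    norm_pos_iff.mpr (ModularForm.eta_ne_zero (rootPoint_mem_upperHalfPlaneSet isPosDefForm_Q₁))
  have hη2 : 0 < ‖ModularForm.eta (rootPoint 2 1 2)‖ :=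
    norm_pos_iff.mpr (ModularForm.eta_ne_zero (rootPoint_mem_upperHalfPlaneSet isPosDefForm_Q₂))
  have hη3 : 0 < ‖ModularForm.eta (rootPoint 1 0 15)‖ :=
    norm_pos_iff.mpr (ModularForm.eta_ne_zero (rootPoint_mem_upperHalfPlaneSet isPosDefForm_Q₃))
  have hη5 : 0 < ‖ModularForm.eta (rootPoint 3 0 5)‖ :=
    norm_pos_iff.mpr (ModularForm.eta_ne_zero (rootPoint_mem_upperHalfPlaneSet isPosDefForm_Q₅))
  have hL : 0 < ‖ModularForm.eta (rootPoint 1 0 15)‖ ^ 4 * ‖ModularForm.eta (rootPoint 3 0 5)‖ ^ 4 := by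
    positivity
  have hR : 0 < 3 / 32 * (‖ModularForm.eta (rootPoint 1 1 4)‖ ^ 4 *
      ‖ModularForm.eta (rootPoint 2 1 2)‖ ^ 4) := by positivity
  refine Real.log_injOn_pos hL hR ?_
  rw [Real.log_mul (by positivity) (by positivity), Real.log_pow, Real.log_pow,
    Real.log_mul (by positivity) (by positivity), Real.log_mul (by positivity) (by positivity),
    Real.log_pow, Real.log_pow]
  have h332 : Real.log (3 / 32) = Real.log 15 + Real.log (15 / 2) - Real.log 60 - Real.log 20 := by
    rw [show (3 / 32 : ℝ) = 15 * (15 / 2) / (60 * 20) by norm_num,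
      Real.log_div (by norm_num) (by norm_num), Real.log_mul (by norm_num) (by norm_num),
      Real.log_mul (by norm_num) (by norm_num)]
    ring
  rw [h332]
  push_cast
  linarith

/-- **The Chowla–Selberg formula for discriminant `−60` in Gamma values** (with the tree's
`chowlaSelberg_fifteen_prod`):
`|η(i√15)|⁴ |η(i√(5/3))|⁴ = Γ(1/15)Γ(2/15)Γ(4/15)Γ(8/15) / (4800 π² Γ(7/15)Γ(11/15)Γ(13/15)Γ(14/15))`.
[folklore] -/
theorem chowlaSelberg_sixty_prod :
    ‖ModularForm.eta (rootPoint 1 0 15)‖ ^ 4 * ‖ModularForm.eta (rootPoint 3 0 5)‖ ^ 4 =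
      Real.Gamma (1 / 15) * Real.Gamma (2 / 15) * Real.Gamma (4 / 15) * Real.Gamma (8 / 15) /
        (Real.Gamma (7 / 15) * Real.Gamma (11 / 15) * Real.Gamma (13 / 15) * Real.Gamma (14 / 15)) /
        (4800 * π ^ 2) := by
  rw [norm_eta_sixty_prod, chowlaSelberg_fifteen_prod]
  have hπ : (π : ℝ) ≠ 0 := Real.pi_ne_zero
  field_simp
  ring

end Literature.NumberTheory.QuadraticFields.ChowlaSelbergSixty

end
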